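import Literature.MathematicalPhysics.QuantumFieldTheory.Balaban1983to89.B6Ineq2134KLevelTorusL0
import Literature.MathematicalPhysics.QuantumFieldTheory.Balaban1983to89.B6Ineq2134KFamKLevelTorus
import Literature.MathematicalPhysics.QuantumFieldTheory.Balaban1983to89.B6Ineq2134DiagIn

/-!
# `Balaban1983to89.B6Ineq2134KFamKLevelTorusInL0` — LEVEL-0 TWIN (programme G-F3′-L0, director-ym LINE №27 / UV3-NODE §24.5; plan `lit-balaban-r03/G-F3L0-PLAN.md`) of `B6Ineq2134KFamKLevelTorusIn`:
the same declarations, SAME NAMES AND STATEMENTS, for nested families WITH print's region `Λ₀ = T ∖ Ω₁` ADMITTED (structures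
`B6MultiLevelBoxOperatorL0.Domains` / `B6MultiLevelTorusOperatorL0.TDomains`: levels `0, …, k`, the level-`0` block a single site, `Q′₀ = id`,
finite weight `a₀` — print p.225 (2.14) «Σ_{j=0}^k … (Q′₀λ)(x) = λ(x), x ∈ Λ₀», p.229 «taking a sequence (2.1) … smallest possible domains B^j(Λ_j),
and considering the operator Δ_a defined by (2.19), (2.20) for this sequence»).  Every `D`-free object is the lineage's, consumed BY NAME; no existing
module is touched; no fact is minted.  Unit `lit-balaban-p33` (p33 gen 89; S-E entry twins named to p33 by the B6 owner r03 gen 36, ruling 2026-08-27T18:45:57Z; port tooling by r03 gen 36); B6 fold owner r03; referee ref-4.  IMPORTS OF THIS TWIN: it consumes no declaration of `B6Ineq2134DiagKLevelTorus(L0)` / `B6Ineq2134KFamKLevelTorus(L0)` — the torus-with-level-0 inputs come from `B6Ineq2134KLevelTorusL0` §1–§2, the `D`-free `theta_pack_le` / `theta0_joint_lt` / `one_le_RLMh` from the ORIGINAL box / torus files (imported through the original `B6Ineq2134KFamKLevelTorus`), so this file is independent of the L0 chain files 2–3.  THE TWIN'S DOCUMENTATION FOLLOWS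
VERBATIM (its «levels 1 … k» / «Ω₁ = X» sentences describe the twin; here `j` runs from `0` and `Ω₁` may be a proper subset).

# `Balaban1983to89.B6Ineq2134KFamKLevelTorusIn` — T. Bałaban, *Propagators and renormalization transformations for lattice gauge theories. II*,
# Commun. Math. Phys. **96** (1984) 223–250 [Balaban1984PropagatorsII], (2.134)–(2.135) p. 247 for the WHOLE (2.91)-family `K_{□,□′}G_{□′}h_{□′}` on the
# genuine multi-level torus — `…B6Ineq2134KFamKLevelTorus.h2134_kFam_torus` RESTATED WITH THE INPUT-LOCALISED `G_□`-HYPOTHESIS of (2.133)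
# (`hGin : InMajorant blk (G c) (T c) (C_G·len²·e^{−δ_G d})`: inputs over the reach, outputs ANYWHERE, decaying) in place of «LocalMajorant + OutLoc»,
# so that members transplanted from a torus WINDOW (r03's `…B6CubeWindowV1.Gl`) can feed it (r03 gen 20, finding F4)

statement-level skeleton of published theorems with citation tags; proofs where landed; nothing here is a claim about the Yang–Mills mass gap

PDF held: `paper:balaban1984-cmp96-propagators-rt-ii` (journal page = PDF page + 222): p. 247 [PDF 25] ((2.133)–(2.135), Prop. 2.6), p. 239 [PDF 17]
((2.91)–(2.93)); read from the tree transcriptions in `…B6Ineq2134KFamKLevelTorus` (p38 gen 25), `…B6Ineq2134DiagKLevelTorus`, `…B6Ineq2134Diag` (r03).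

CITATION HEADER (lean-in-tree rule) — WHAT IS REPRODUCED.  Phase-2 file of the `lit-balaban` typed skeleton (HOME `run/shared/lean/pub/lit-balaban/`), seat
**p38 gen 27**; owner r03 gen 20's interface finding F4 (seat INBOX 2026-08-23T05:45Z–05:56:57Z) and p38's answer (06:13Z: Option B-form — the weakest
G-hypothesis the (2.134) proofs consume is the input-localised, all-outputs, DECAYING bound; `hGout` is not needed); SKELETON rows **B6.Eq2.134** ×
**B6.Eq2.133** × **B6.Prop2.6** (cells only; decls of record untouched).  THIS FILE = the torus port (files 2–3 of p38 gen 25) re-run on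
`…B6Ineq2134DiagIn.diag_hasMajorant_inout` (v1.1):
* §1 `ineq2134_diag_torus_in`, `ineq2134_kDiag_torus_in`, `ineq2134_kDiag_torus_theta_in` — the diagonal pairs, `K_{□,□} = kDiag` by name, `θ₀ = Θ·U/M`;
* §2 **`h2134_kFam_torus_in`** — ALL pairs of the (2.91)-family, ONE threshold `M₀`, ONE `Θ`: the hypothesis list of `h2134_kFam_torus` with
  `(hG : ∀ c, LocalMajorant blk (G c) (T c) …)` + `(hGout : ∀ c, OutLoc blk (G c) (T c))` REPLACED by
  **`hGin : ∀ c ∈ Dc, InMajorant blk (G c) (T c) (fun y y′ => C_G·len y²·e^{−δ_G d(y,y′)})`**, the partners `N c k`, `Pl c` by the PAIRS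
  `hNin`/`hNout`, `hPlin`/`hPlout` (In-localised: r03's `InMajorant` over `T c`; Out-localised: outputs over `T c`, inputs anywhere — stated expanded), and
  the first-order pieces with the TWO-power split `hEG : LocalMajorant (E c e * G c) (T c) (C₁·len²·e^{−δ_G d})`, `hcf : |cf c e x| ≤ s₁/(M·len(blk x)²)`
  (r03 gen 21's accounting of `EC e * Gl c` / p38's `cfC`); everything else (hdec, hc₀, h, hLip, hz, hζ, hD3, hgap) and the conclusion
  `HasMajorant blk ((K_{□,□′}·G_{□′})·h_{□′}) (θ₀·e^{−(δ_G/2)d})`, `θ₀ = Θ·(C_PC_G/m + U)/M`, UNCHANGED;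
* §3 `inputs2134_kFam_torus_in` — the same with `N²θ₀c₁ < 1` above one threshold.
THEOREMS ONLY (no `def`, no `def … : Prop`, no new hypothesis-shaped fact); standard axioms.

HONEST SCOPE / DIVERGENCES. As `…B6Ineq2134KFamKLevelTorus` (per-cube inputs displayed; `∂P∂*` a hypothesis; lattice units `η = 1`; constants `L`-dependent,
`k`/`M_h`-independent; integer torus); the off-diagonal pairs use only the local majorant on `S c ⊆ T c` (`InMajorant.localMajorant`).  For a window
member, `hGin` with GLOBAL-distance decay holds for CENTRED fundamental domains at a reduced rate (r03's `κδ`); `δ_G` is a free parameter here.  Nothing on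
d = 4 or the continuum; NOT summit progress.  Unit `lit-balaban-p38` (gen 27), 2026-08-23.
-/

namespace Literature.MathematicalPhysics.QuantumFieldTheory.Balaban1983to89.B6Ineq2134KFamKLevelTorusInL0

open Literature.MathematicalPhysics.QuantumFieldTheory.Balaban1983to89.B6MultiLevelTorusOperatorL0 (TDomains)
open Literature.MathematicalPhysics.QuantumFieldTheory.Balaban1983to89.B8Ineq192MultiLevelTorusL0 (geomTB geomTB_L geomTB_M levelSepTB)
open Literature.MathematicalPhysics.QuantumFieldTheory.Balaban1983to89.B6Ineq261LevelGap (K261 K261_nonneg)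
open Literature.MathematicalPhysics.QuantumFieldTheory.Balaban1983to89.B6RandomWalk (HasMajorant BlockSupp hasMajorant_mono)
open Literature.MathematicalPhysics.QuantumFieldTheory.Balaban1983to89.B6Prop26Gluing (mulOp mulOp_apply LocalMajorant)
open Literature.MathematicalPhysics.QuantumFieldTheory.Balaban1983to89.B6Ineq268 (LevelSep)
open Literature.MathematicalPhysics.QuantumFieldTheory.Balaban1983to89.B6Lemma21Repaired (Ineq263With)
open Literature.MathematicalPhysics.QuantumFieldTheory.Balaban1983to89.B6InMajorantTransplant (InMajorant inMajorant_subset)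
open Literature.MathematicalPhysics.QuantumFieldTheory.Balaban1983to89.B6Ineq2134DiagIn (diag_hasMajorant_inout)
open Literature.MathematicalPhysics.QuantumFieldTheory.Balaban1983to89.B6Ineq2134KLevelTorus (one_le_RLMh)
open Literature.MathematicalPhysics.QuantumFieldTheory.Balaban1983to89.B6Ineq2134KLevelTorusL0 (one_le_L_TB eta_pos_TB M_pos_TB RM_nonneg_TB dist_nonneg_TB ineq263_geomTB thr_geomTB ineq2134_kOff_torus)
open Literature.MathematicalPhysics.QuantumFieldTheory.Balaban1983to89.B6Ineq2134DiagKLevel (theta_pack_le)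
open Literature.MathematicalPhysics.QuantumFieldTheory.Balaban1983to89.B6Ineq2134KFamKLevel (theta0_joint_lt)
open Literature.MathematicalPhysics.QuantumFieldTheory.Balaban1983to89.B6Eq291Generator (kDiag kOff kFam)

variable {d ℓ : ℕ}

/-- `a ≤ (a + 1)(b + 1)` for `a, b ≥ 0`. [folklore] -/
private theorem le_mul_succ_left {a b : ℝ} (ha : 0 ≤ a) (hb : 0 ≤ b) : a ≤ (a + 1) * (b + 1) := by nlinarith

/-! ## §1  (2.134) for □ = □′ on the torus, `G_□` input-localised -/

/-- **(2.134) FOR THE DIAGONAL PAIRS ON THE GENUINE MULTI-LEVEL TORUS, `G_□` INPUT-LOCALISED** — `…B6Ineq2134DiagKLevelTorus.ineq2134_diag_torus` with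
`(hG, hGout)` replaced by `hGin : InMajorant blk Gl S (C_G·len²·e^{−δd})` ((2.133) as printed: inputs over the reach, outputs anywhere); (2.60), (2.63),
`L² ≤ e^{⅛δRM}` discharged as there; ONE threshold, ONE constant. [cite: Balaban1984PropagatorsII, (2.134) p.247; (2.133) p.247; (2.92) p.239; Lemma 2.1 (2.60), (2.63) p.234] -/
theorem ineq2134_diag_torus_in (d ℓ : ℕ) {δ : ℝ} (hδ : 0 < δ) :
    ∃ M₀ c : ℝ, 0 < M₀ ∧ 0 ≤ c ∧
      ∀ {Mh k R : ℕ} {P : Fin (d + 1) → ℕ} (D : B6MultiLevelTorusOperatorL0.TDomains d ℓ Mh k P R), 1 ≤ Mh → (∀ μ, 1 ≤ P μ) → 2 * (ℓ + 1) ≤ R →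
        M₀ ≤ ((ℓ : ℝ) + 1) * Mh → ∀ {X : Type} (blk : X → (geomTB D).Site),
        ∀ {CG C₁ CN CD cD s s₁ s₂ r₀ : ℝ}, 0 ≤ CG → 0 ≤ C₁ → 0 ≤ CN → 0 ≤ CD → 0 ≤ s → 0 ≤ s₁ → 0 ≤ s₂ → 0 ≤ r₀ →
        ∀ {Gl Pl D₃ : Module.End ℝ (X → ℝ)} {hI c₀ ζ : X → ℝ} {S : Set (geomTB D).Site}
          {ι : Type} (DE : Finset ι) {E : ι → Module.End ℝ (X → ℝ)} {cf : ι → X → ℝ}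
          {κ : Type} (DK : Finset κ) {N : κ → Module.End ℝ (X → ℝ)} {z : κ → X → ℝ},
          InMajorant blk Gl S (fun y y' => CG * (geomTB D).len y ^ 2 * Real.exp (-(δ * (geomTB D).dist y y'))) →
          (∀ e ∈ DE, LocalMajorant blk (E e * Gl) S (fun y y' => C₁ * (geomTB D).len y ^ 2 * Real.exp (-(δ * (geomTB D).dist y y')))) →
          (∀ e ∈ DE, ∀ x, |cf e x| ≤ s₁ / ((geomTB D).M * (geomTB D).len (blk x) ^ 2)) → (∀ e ∈ DE, ∀ x, cf e x ≠ 0 → blk x ∈ S) →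
          (∀ x, |c₀ x| ≤ s₂ / ((geomTB D).M * (geomTB D).len (blk x) ^ 2)) → (∀ x, c₀ x ≠ 0 → blk x ∈ S) →
          (∀ x, |hI x| ≤ 1) → (∀ x, hI x ≠ 0 → blk x ∈ S) →
          (∀ x x', |hI x' - hI x| ≤ s / (geomTB D).M * ((geomTB D).dist (blk x) (blk x') + r₀)) →
          (∀ k ∈ DK, InMajorant blk (N k) S (fun y y'' => CN / (geomTB D).len y ^ 2 * Real.exp (-(δ * (geomTB D).dist y y'')))) →
          (∀ k ∈ DK, ∀ (y'' : (geomTB D).Site) (μ : X → ℝ) (B : ℝ), BlockSupp blk μ y'' B → ∀ x, blk x ∈ S →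
            |N k μ x| ≤ CN / (geomTB D).len (blk x) ^ 2 * Real.exp (-(δ * (geomTB D).dist (blk x) y'')) * B) →
          (∀ k ∈ DK, ∀ x, |z k x| ≤ 1) →
          InMajorant blk Pl S (fun y y'' => CN / (geomTB D).len y ^ 2 * Real.exp (-(δ * (geomTB D).dist y y''))) →
          (∀ (y'' : (geomTB D).Site) (μ : X → ℝ) (B : ℝ), BlockSupp blk μ y'' B → ∀ x, blk x ∈ S →
            |Pl μ x| ≤ CN / (geomTB D).len (blk x) ^ 2 * Real.exp (-(δ * (geomTB D).dist (blk x) y'')) * B) →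
          (∀ x, |ζ x| ≤ 1) →
          HasMajorant blk D₃ (fun y y'' => CD * Real.exp (-(cD * (geomTB D).M)) / (geomTB D).len y ^ 2 * Real.exp (-(δ * (geomTB D).dist y y''))) →
          HasMajorant blk
            ((((∑ e ∈ DE, mulOp (cf e) * E e - mulOp c₀) +
                ((∑ k ∈ DK, mulOp (z k) * (N k * mulOp hI - mulOp hI * N k)) + mulOp ζ * (Pl * mulOp hI - mulOp hI * Pl))) + D₃) *
              Gl * mulOp hI)
            (fun y y' =>
              ((DE.card * (s₁ * C₁) + s₂ * CG) / (geomTB D).M +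
                    (DK.card + 1) * (s / (geomTB D).M * (CN * CG * (geomTB D).L ^ 2 * (8 / δ + r₀)) * c ^ 2) +
                  CD * Real.exp (-(cD * (geomTB D).M)) * CG * (geomTB D).L ^ 2 * c ^ 2) *
                Real.exp (-(1 / 2 * δ * (geomTB D).dist y y'))) := by
  classical
  -- (2.63) at `(¾δ, ⅓)`, the largeness threshold, the constant
  obtain ⟨N₀, hN₀pos, h263⟩ := ineq263_geomTB d ℓ hδ
  obtain ⟨N₂, hthr⟩ := thr_geomTB d ℓ hδ
  obtain ⟨c, hc⟩ : ∃ c : ℝ, c = K261 N₀ (d + 1) ((ℓ : ℝ) + 1) 1 (1 / 3 * (3 / 4 * δ)) := ⟨_, rfl⟩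
  have hcnn : 0 ≤ c := by rw [hc]; exact K261_nonneg (by positivity) zero_le_one
  obtain ⟨M₀, hM₀⟩ : ∃ M₀ : ℝ, M₀ = max ((N₀ : ℝ) + 1) ((N₂ : ℝ) + 1) := ⟨_, rfl⟩
  refine ⟨M₀, c, by rw [hM₀]; exact lt_max_of_lt_left (by positivity), hcnn, ?_⟩
  intro Mh k R P D hMh hP hR hM X blk CG C₁ CN CD cD s s₁ s₂ r₀ hCG hC₁ hCN hCD hs hs₁ hs₂ hr₀ Gl Pl D₃ hI c₀ ζ S ι DE E cf κ DK N z hGin hEG hcf hcfS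
    hc₀ hc₀S hI1 hIS hLip hNin hNout hz hPlin hPlout hζ hD
  -- the member's thresholds and side facts
  have hMN₀ : (N₀ : ℝ) + 1 ≤ ((ℓ : ℝ) + 1) * Mh := (le_max_left _ _).trans (hM₀ ▸ hM)
  have hMN₂ : (N₂ : ℝ) + 1 ≤ ((ℓ : ℝ) + 1) * Mh := (le_max_right _ _).trans (hM₀ ▸ hM)
  have hL1 := one_le_L_TB D
  have hη := eta_pos_TB D
  have hMpos := M_pos_TB D hMh
  have hRM := RM_nonneg_TB D hMh hR
  have h263i : Ineq263With c (geomTB D) (3 / 4 * δ) (1 / 3) := by rw [hc]; exact h263 D hMh hP hR hMN₀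
  -- lines 2 and 4 as ONE commutator family indexed by `Option κ` (`none` = the line-4 partner `∂P_□∂*`)
  have hN'in : ∀ o ∈ Finset.insertNone DK, InMajorant blk ((fun o : Option κ => o.elim Pl N) o) S
      (fun y y'' => CN / (geomTB D).len y ^ 2 * Real.exp (-(δ * (geomTB D).dist y y''))) := by
    intro o ho
    cases o with
    | none => exact hPlin
    | some k => exact hNin k (Finset.some_mem_insertNone.1 ho)
  have hN'out : ∀ o ∈ Finset.insertNone DK, ∀ (y'' : (geomTB D).Site) (μ : X → ℝ) (B : ℝ), BlockSupp blk μ y'' B → ∀ x, blk x ∈ S →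
      |((fun o : Option κ => o.elim Pl N) o) μ x| ≤ CN / (geomTB D).len (blk x) ^ 2 * Real.exp (-(δ * (geomTB D).dist (blk x) y'')) * B := by
    intro o ho
    cases o with
    | none => exact hPlout
    | some k => exact hNout k (Finset.some_mem_insertNone.1 ho)
  have hz'le : ∀ o ∈ Finset.insertNone DK, ∀ x, |(fun o : Option κ => o.elim ζ z) o x| ≤ 1 := by
    intro o ho x
    cases o with
    | none => exact hζ x
    | some k => exact hz k (Finset.some_mem_insertNone.1 ho) x
  have hsum : (∑ k ∈ DK, mulOp (z k) * (N k * mulOp hI - mulOp hI * N k)) + mulOp ζ * (Pl * mulOp hI - mulOp hI * Pl) =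
      ∑ o ∈ Finset.insertNone DK,
        mulOp ((fun o : Option κ => o.elim ζ z) o) *
          ((fun o : Option κ => o.elim Pl N) o * mulOp hI - mulOp hI * (fun o : Option κ => o.elim Pl N) o) := by
    rw [Finset.sum_insertNone]
    exact add_comm _ _
  have key := diag_hasMajorant_inout blk hL1 hη (levelSepTB D hMh hP (one_le_RLMh hMh hR)) (dist_nonneg_TB D hMh hP) hδ hCG hC₁ hCN hCD hs hs₁ hs₂ hr₀
    hMpos hRM (hthr D hMh hR hMN₂) h263i DE (Finset.insertNone DK) (N := fun o : Option κ => o.elim Pl N) (z := fun o : Option κ => o.elim ζ z)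
    hGin hEG hcf hcfS hc₀ hc₀S hI1 hIS hLip hN'in hN'out hz'le hD
  rw [hsum, mul_assoc]
  refine hasMajorant_mono _ key fun y y' => le_of_eq ?_
  rw [Finset.card_insertNone]
  push_cast
  ring

/-- **(2.134) FOR `K_{□,□} = kDiag (∂P∂*) h_□ ζ_□ M_□ P_□` BY NAME, ON THE TORUS, `G_□` INPUT-LOCALISED** (`…ineq2134_kDiag_torus` with `(hG, hGout) ↦ hGin`).
[cite: Balaban1984PropagatorsII, (2.134) p.247; (2.133) p.247; (2.92) p.239] -/
theorem ineq2134_kDiag_torus_in (d ℓ : ℕ) {δ : ℝ} (hδ : 0 < δ) :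
    ∃ M₀ c : ℝ, 0 < M₀ ∧ 0 ≤ c ∧
      ∀ {Mh k R : ℕ} {P : Fin (d + 1) → ℕ} (D : B6MultiLevelTorusOperatorL0.TDomains d ℓ Mh k P R), 1 ≤ Mh → (∀ μ, 1 ≤ P μ) → 2 * (ℓ + 1) ≤ R →
        M₀ ≤ ((ℓ : ℝ) + 1) * Mh → ∀ {X : Type} (blk : X → (geomTB D).Site) (Dg : Module.End ℝ (X → ℝ)),
        ∀ {CG C₁ CN CD cD s s₁ s₂ r₀ : ℝ}, 0 ≤ CG → 0 ≤ C₁ → 0 ≤ CN → 0 ≤ CD → 0 ≤ s → 0 ≤ s₁ → 0 ≤ s₂ → 0 ≤ r₀ →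
        ∀ {Gl Ml Pl : Module.End ℝ (X → ℝ)} {hI c₀ ζ : X → ℝ} {S : Set (geomTB D).Site}
          {ι : Type} (DE : Finset ι) {E : ι → Module.End ℝ (X → ℝ)} {cf : ι → X → ℝ}
          {κ : Type} (DK : Finset κ) {N : κ → Module.End ℝ (X → ℝ)} {z : κ → X → ℝ},
          mulOp hI * Ml - Ml * mulOp hI =
            (∑ e ∈ DE, mulOp (cf e) * E e - mulOp c₀) + ∑ k ∈ DK, mulOp (z k) * (N k * mulOp hI - mulOp hI * N k) →
          InMajorant blk Gl S (fun y y' => CG * (geomTB D).len y ^ 2 * Real.exp (-(δ * (geomTB D).dist y y'))) →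
          (∀ e ∈ DE, LocalMajorant blk (E e * Gl) S (fun y y' => C₁ * (geomTB D).len y ^ 2 * Real.exp (-(δ * (geomTB D).dist y y')))) →
          (∀ e ∈ DE, ∀ x, |cf e x| ≤ s₁ / ((geomTB D).M * (geomTB D).len (blk x) ^ 2)) → (∀ e ∈ DE, ∀ x, cf e x ≠ 0 → blk x ∈ S) →
          (∀ x, |c₀ x| ≤ s₂ / ((geomTB D).M * (geomTB D).len (blk x) ^ 2)) → (∀ x, c₀ x ≠ 0 → blk x ∈ S) →
          (∀ x, |hI x| ≤ 1) → (∀ x, hI x ≠ 0 → blk x ∈ S) →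
          (∀ x x', |hI x' - hI x| ≤ s / (geomTB D).M * ((geomTB D).dist (blk x) (blk x') + r₀)) →
          (∀ k ∈ DK, InMajorant blk (N k) S (fun y y'' => CN / (geomTB D).len y ^ 2 * Real.exp (-(δ * (geomTB D).dist y y'')))) →
          (∀ k ∈ DK, ∀ (y'' : (geomTB D).Site) (μ : X → ℝ) (B : ℝ), BlockSupp blk μ y'' B → ∀ x, blk x ∈ S →
            |N k μ x| ≤ CN / (geomTB D).len (blk x) ^ 2 * Real.exp (-(δ * (geomTB D).dist (blk x) y'')) * B) →
          (∀ k ∈ DK, ∀ x, |z k x| ≤ 1) →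
          InMajorant blk Pl S (fun y y'' => CN / (geomTB D).len y ^ 2 * Real.exp (-(δ * (geomTB D).dist y y''))) →
          (∀ (y'' : (geomTB D).Site) (μ : X → ℝ) (B : ℝ), BlockSupp blk μ y'' B → ∀ x, blk x ∈ S →
            |Pl μ x| ≤ CN / (geomTB D).len (blk x) ^ 2 * Real.exp (-(δ * (geomTB D).dist (blk x) y'')) * B) →
          (∀ x, |ζ x| ≤ 1) →
          HasMajorant blk (mulOp ζ * (Dg - Pl) * mulOp hI)
            (fun y y'' => CD * Real.exp (-(cD * (geomTB D).M)) / (geomTB D).len y ^ 2 * Real.exp (-(δ * (geomTB D).dist y y''))) →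
          HasMajorant blk ((kDiag Dg (mulOp hI) (mulOp ζ) Ml Pl * Gl) * mulOp hI)
            (fun y y' =>
              ((DE.card * (s₁ * C₁) + s₂ * CG) / (geomTB D).M +
                    (DK.card + 1) * (s / (geomTB D).M * (CN * CG * (geomTB D).L ^ 2 * (8 / δ + r₀)) * c ^ 2) +
                  CD * Real.exp (-(cD * (geomTB D).M)) * CG * (geomTB D).L ^ 2 * c ^ 2) *
                Real.exp (-(1 / 2 * δ * (geomTB D).dist y y'))) := by
  obtain ⟨M₀, c, hM₀, hc, hall⟩ := ineq2134_diag_torus_in d ℓ hδ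
  refine ⟨M₀, c, hM₀, hc, ?_⟩
  intro Mh k R P D hMh hP hR hM X blk Dg CG C₁ CN CD cD s s₁ s₂ r₀ hCG hC₁ hCN hCD hs hs₁ hs₂ hr₀ Gl Ml Pl hI c₀ ζ S ι DE E cf κ DK N z hdec hGin hEG hcf
    hcfS hc₀ hc₀S hI1 hIS hLip hNin hNout hz hPlin hPlout hζ hD
  have key := hall D hMh hP hR hM blk hCG hC₁ hCN hCD hs hs₁ hs₂ hr₀ (Gl := Gl) (Pl := Pl) (D₃ := mulOp ζ * (Dg - Pl) * mulOp hI) (ζ := ζ)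
    DE DK hGin hEG hcf hcfS hc₀ hc₀S hI1 hIS hLip hNin hNout hz hPlin hPlout hζ hD
  -- `kDiag` = line 1 + (line 2 + line 4) + line 3, by `hdec`
  have e : kDiag Dg (mulOp hI) (mulOp ζ) Ml Pl =
      ((∑ e ∈ DE, mulOp (cf e) * E e - mulOp c₀) +
          ((∑ k ∈ DK, mulOp (z k) * (N k * mulOp hI - mulOp hI * N k)) + mulOp ζ * (Pl * mulOp hI - mulOp hI * Pl))) +
        mulOp ζ * (Dg - Pl) * mulOp hI := by
    unfold kDiag
    rw [hdec]
    abel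
  rw [e]
  exact key

/-- **(2.134) FOR `K_{□,□}G_□h_□`, THE `O(M⁻¹)` PACKAGED, `G_□` INPUT-LOCALISED**: `θ₀ = Θ·U/M` (`…ineq2134_kDiag_torus_theta` with `(hG, hGout) ↦ hGin`).
[cite: Balaban1984PropagatorsII, (2.134) p.247; (2.133) p.247; (2.92) p.239; p.238 (remarks)] -/
theorem ineq2134_kDiag_torus_theta_in (d ℓ : ℕ) {δ : ℝ} (hδ : 0 < δ) :
    ∃ M₀ Θ : ℝ, 0 < M₀ ∧ 0 ≤ Θ ∧
      ∀ {Mh k R : ℕ} {P : Fin (d + 1) → ℕ} (D : B6MultiLevelTorusOperatorL0.TDomains d ℓ Mh k P R), 1 ≤ Mh → (∀ μ, 1 ≤ P μ) → 2 * (ℓ + 1) ≤ R →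
        M₀ ≤ ((ℓ : ℝ) + 1) * Mh → ∀ {X : Type} (blk : X → (geomTB D).Site) (Dg : Module.End ℝ (X → ℝ)),
        ∀ {CG C₁ CN CD cD s s₁ s₂ r₀ : ℝ}, 0 ≤ CG → 0 ≤ C₁ → 0 ≤ CN → 0 ≤ CD → 0 < cD → 0 ≤ s → 0 ≤ s₁ → 0 ≤ s₂ → 0 ≤ r₀ →
        ∀ {Gl Ml Pl : Module.End ℝ (X → ℝ)} {hI c₀ ζ : X → ℝ} {S : Set (geomTB D).Site}
          {ι : Type} (DE : Finset ι) {E : ι → Module.End ℝ (X → ℝ)} {cf : ι → X → ℝ}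
          {κ : Type} (DK : Finset κ) {N : κ → Module.End ℝ (X → ℝ)} {z : κ → X → ℝ},
          mulOp hI * Ml - Ml * mulOp hI =
            (∑ e ∈ DE, mulOp (cf e) * E e - mulOp c₀) + ∑ k ∈ DK, mulOp (z k) * (N k * mulOp hI - mulOp hI * N k) →
          InMajorant blk Gl S (fun y y' => CG * (geomTB D).len y ^ 2 * Real.exp (-(δ * (geomTB D).dist y y'))) →
          (∀ e ∈ DE, LocalMajorant blk (E e * Gl) S (fun y y' => C₁ * (geomTB D).len y ^ 2 * Real.exp (-(δ * (geomTB D).dist y y')))) →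
          (∀ e ∈ DE, ∀ x, |cf e x| ≤ s₁ / ((geomTB D).M * (geomTB D).len (blk x) ^ 2)) → (∀ e ∈ DE, ∀ x, cf e x ≠ 0 → blk x ∈ S) →
          (∀ x, |c₀ x| ≤ s₂ / ((geomTB D).M * (geomTB D).len (blk x) ^ 2)) → (∀ x, c₀ x ≠ 0 → blk x ∈ S) →
          (∀ x, |hI x| ≤ 1) → (∀ x, hI x ≠ 0 → blk x ∈ S) →
          (∀ x x', |hI x' - hI x| ≤ s / (geomTB D).M * ((geomTB D).dist (blk x) (blk x') + r₀)) →
          (∀ k ∈ DK, InMajorant blk (N k) S (fun y y'' => CN / (geomTB D).len y ^ 2 * Real.exp (-(δ * (geomTB D).dist y y'')))) →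
          (∀ k ∈ DK, ∀ (y'' : (geomTB D).Site) (μ : X → ℝ) (B : ℝ), BlockSupp blk μ y'' B → ∀ x, blk x ∈ S →
            |N k μ x| ≤ CN / (geomTB D).len (blk x) ^ 2 * Real.exp (-(δ * (geomTB D).dist (blk x) y'')) * B) →
          (∀ k ∈ DK, ∀ x, |z k x| ≤ 1) →
          InMajorant blk Pl S (fun y y'' => CN / (geomTB D).len y ^ 2 * Real.exp (-(δ * (geomTB D).dist y y''))) →
          (∀ (y'' : (geomTB D).Site) (μ : X → ℝ) (B : ℝ), BlockSupp blk μ y'' B → ∀ x, blk x ∈ S →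
            |Pl μ x| ≤ CN / (geomTB D).len (blk x) ^ 2 * Real.exp (-(δ * (geomTB D).dist (blk x) y'')) * B) →
          (∀ x, |ζ x| ≤ 1) →
          HasMajorant blk (mulOp ζ * (Dg - Pl) * mulOp hI)
            (fun y y'' => CD * Real.exp (-(cD * (geomTB D).M)) / (geomTB D).len y ^ 2 * Real.exp (-(δ * (geomTB D).dist y y''))) →
          HasMajorant blk ((kDiag Dg (mulOp hI) (mulOp ζ) Ml Pl * Gl) * mulOp hI)
            (fun y y' => Θ * (DE.card * (s₁ * C₁) + s₂ * CG + (DK.card + 1) * s * ((CN + 1) * CG * (1 + r₀)) + CD * CG / cD) *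
              ((geomTB D).M)⁻¹ * Real.exp (-(δ / 2 * (geomTB D).dist y y'))) := by
  obtain ⟨M₀, c, hM₀, hc, hall⟩ := ineq2134_kDiag_torus_in d ℓ hδ
  obtain ⟨Θ, hΘ⟩ : ∃ Θ : ℝ, Θ = ((ℓ : ℝ) + 1) ^ 2 * c ^ 2 * (0 + 1) * (8 / δ + 1) + 1 := ⟨_, rfl⟩
  have hΘnn : 0 ≤ Θ := by rw [hΘ]; positivity
  refine ⟨M₀, Θ, hM₀, hΘnn, ?_⟩
  intro Mh k R P D hMh hP hR hM X blk Dg CG C₁ CN CD cD s s₁ s₂ r₀ hCG hC₁ hCN hCD hcD hs hs₁ hs₂ hr₀ Gl Ml Pl hI c₀ ζ S ι DE E cf κ DK N z hdec hGin hEG hcf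
    hcfS hc₀ hc₀S hI1 hIS hLip hNin hNout hz hPlin hPlout hζ hD
  have hMpos : 0 < (geomTB D).M := M_pos_TB D hMh
  have key := hall D hMh hP hR hM blk Dg hCG hC₁ hCN hCD hs hs₁ hs₂ hr₀ DE DK hdec hGin hEG hcf hcfS hc₀ hc₀S hI1 hIS hLip hNin hNout hz hPlin hPlout hζ hD
  refine hasMajorant_mono _ key fun y y' => ?_
  have hθ := theta_pack_le (L := (geomTB D).L) (c := c) (CP := 0) (CN' := CN) DE.card DK.card hMpos hδ le_rfl hCN (le_mul_succ_left hCN le_rfl) hCN hCG hC₁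
    hCD hcD hs hs₁ hs₂ hr₀
  rw [geomTB_L] at hθ ⊢
  rw [← hΘ] at hθ
  have h1 : Real.exp (-(1 / 2 * δ * (geomTB D).dist y y')) = Real.exp (-(δ / 2 * (geomTB D).dist y y')) := by ring_nf
  rw [h1]
  exact mul_le_mul_of_nonneg_right hθ (Real.exp_nonneg _)

/-! ## §2  (2.134) for the whole (2.91)-family on the torus, `G_□` input-localised -/

/-- **(2.134) FOR THE WHOLE (2.91)-FAMILY ON THE GENUINE MULTI-LEVEL TORUS, `G_□` INPUT-LOCALISED AS IN (2.133)** — `…h2134_kFam_torus` with the pair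
`(hG : LocalMajorant blk (G c) (T c) …, hGout : OutLoc blk (G c) (T c))` replaced by the single
**`hGin : ∀ c ∈ Dc, InMajorant blk (G c) (T c) (fun y y′ => C_G·len y²·e^{−δ_G d(y,y′)})`** (inputs over the reach `T c`, outputs anywhere, decaying —
what (2.133) prints and what a member transplanted from a CENTRED torus window satisfies); every other hypothesis and the conclusion
`HasMajorant blk ((K_{□,□′}·G_{□′})·h_{□′}) (θ₀·e^{−(δ_G/2)d})`, **`θ₀ = Θ·(C_PC_G/m + U)/M`**, unchanged (ONE `M₀`, ONE `Θ` on `d, L, δ_G`).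
[cite: Balaban1984PropagatorsII, (2.134)–(2.135) p.247; (2.133) p.247; (2.91)–(2.93) p.239] -/
theorem h2134_kFam_torus_in (d ℓ : ℕ) {δG : ℝ} (hδG : 0 < δG) :
    ∃ M₀ Θ : ℝ, 0 < M₀ ∧ 0 ≤ Θ ∧
      ∀ {Mh k R : ℕ} {P : Fin (d + 1) → ℕ} (D : B6MultiLevelTorusOperatorL0.TDomains d ℓ Mh k P R), 1 ≤ Mh → (∀ μ, 1 ≤ P μ) → 2 * (ℓ + 1) ≤ R →
        M₀ ≤ ((ℓ : ℝ) + 1) * Mh → ∀ {X : Type} (blk : X → (geomTB D).Site) {Dg : Module.End ℝ (X → ℝ)} {CP : ℝ}, 0 ≤ CP →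
        HasMajorant blk Dg (fun y y'' => CP / (geomTB D).len y ^ 2 * Real.exp (-(δG * (geomTB D).dist y y''))) →
        ∀ {CG C₁ CN CD cD s s₁ s₂ r₀ m : ℝ}, 0 ≤ CG → 0 ≤ C₁ → 0 ≤ CN → 0 ≤ CD → 0 < cD → 0 ≤ s → 0 ≤ s₁ → 0 ≤ s₂ → 0 ≤ r₀ → 0 < m →
        ∀ (nE nK : ℕ) {C : Type} [DecidableEq C] (Dc : Finset C) {G Ml Pl : C → Module.End ℝ (X → ℝ)} {h ζ c₀ : C → X → ℝ}
          {T S Score : C → Set (geomTB D).Site}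
          {ι : Type} {DE : C → Finset ι} {E : C → ι → Module.End ℝ (X → ℝ)} {cf : C → ι → X → ℝ}
          {κ : Type} {DK : C → Finset κ} {N : C → κ → Module.End ℝ (X → ℝ)} {z : C → κ → X → ℝ},
          (∀ c ∈ Dc, (DE c).card ≤ nE) → (∀ c ∈ Dc, (DK c).card ≤ nK) →
          (∀ c ∈ Dc, mulOp (h c) * Ml c - Ml c * mulOp (h c) =
            (∑ e ∈ DE c, mulOp (cf c e) * E c e - mulOp (c₀ c)) + ∑ k ∈ DK c, mulOp (z c k) * (N c k * mulOp (h c) - mulOp (h c) * N c k)) →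
          (∀ c ∈ Dc, InMajorant blk (G c) (T c) (fun y y' => CG * (geomTB D).len y ^ 2 * Real.exp (-(δG * (geomTB D).dist y y')))) →
          (∀ c ∈ Dc, ∀ e ∈ DE c,
            LocalMajorant blk (E c e * G c) (T c) (fun y y' => C₁ * (geomTB D).len y ^ 2 * Real.exp (-(δG * (geomTB D).dist y y')))) →
          (∀ c ∈ Dc, ∀ e ∈ DE c, ∀ x, |cf c e x| ≤ s₁ / ((geomTB D).M * (geomTB D).len (blk x) ^ 2)) →
          (∀ c ∈ Dc, ∀ e ∈ DE c, ∀ x, cf c e x ≠ 0 → blk x ∈ T c) →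
          (∀ c ∈ Dc, ∀ x, |c₀ c x| ≤ s₂ / ((geomTB D).M * (geomTB D).len (blk x) ^ 2)) → (∀ c ∈ Dc, ∀ x, c₀ c x ≠ 0 → blk x ∈ T c) →
          (∀ c ∈ Dc, ∀ x, |h c x| ≤ 1) → (∀ c ∈ Dc, ∀ x, h c x ≠ 0 → blk x ∈ S c) → (∀ c ∈ Dc, S c ⊆ T c) →
          (∀ c ∈ Dc, ∀ x x', |h c x' - h c x| ≤ s / (geomTB D).M * ((geomTB D).dist (blk x) (blk x') + r₀)) →
          (∀ c ∈ Dc, ∀ k ∈ DK c,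
            InMajorant blk (N c k) (T c) (fun y y'' => CN / (geomTB D).len y ^ 2 * Real.exp (-(δG * (geomTB D).dist y y'')))) →
          (∀ c ∈ Dc, ∀ k ∈ DK c, ∀ (y'' : (geomTB D).Site) (μ : X → ℝ) (B : ℝ), BlockSupp blk μ y'' B → ∀ x, blk x ∈ T c →
            |N c k μ x| ≤ CN / (geomTB D).len (blk x) ^ 2 * Real.exp (-(δG * (geomTB D).dist (blk x) y'')) * B) →
          (∀ c ∈ Dc, ∀ k ∈ DK c, ∀ x, |z c k x| ≤ 1) →
          (∀ c ∈ Dc, InMajorant blk (Pl c) (T c) (fun y y'' => CN / (geomTB D).len y ^ 2 * Real.exp (-(δG * (geomTB D).dist y y'')))) →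
          (∀ c ∈ Dc, ∀ (y'' : (geomTB D).Site) (μ : X → ℝ) (B : ℝ), BlockSupp blk μ y'' B → ∀ x, blk x ∈ T c →
            |Pl c μ x| ≤ CN / (geomTB D).len (blk x) ^ 2 * Real.exp (-(δG * (geomTB D).dist (blk x) y'')) * B) →
          (∀ c ∈ Dc, ∀ x, 0 ≤ ζ c x) → (∀ c ∈ Dc, ∀ x, ζ c x ≤ 1) → (∀ c ∈ Dc, ∀ x, ζ c x ≠ 1 → blk x ∉ Score c) →
          (∀ c ∈ Dc, HasMajorant blk (mulOp (ζ c) * (Dg - Pl c) * mulOp (h c))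
            (fun y y'' => CD * Real.exp (-(cD * (geomTB D).M)) / (geomTB D).len y ^ 2 * Real.exp (-(δG * (geomTB D).dist y y'')))) →
          (∀ c ∈ Dc, ∀ y y'', y ∉ Score c → y'' ∈ S c → m * (geomTB D).M ≤ (geomTB D).dist y y'') →
          ∀ c ∈ Dc, ∀ c' ∈ Dc,
            HasMajorant blk
              ((kFam Dg (fun c => mulOp (h c)) (fun c => mulOp (ζ c)) Ml Pl c c' * G c') * mulOp (h c'))
              (fun y y' => Θ * (CP * CG / m + (nE * (s₁ * C₁) + s₂ * CG + (nK + 1) * s * ((CN + 1) * CG * (1 + r₀)) + CD * CG / cD)) *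
                ((geomTB D).M)⁻¹ * Real.exp (-(δG / 2 * (geomTB D).dist y y'))) := by
  obtain ⟨M₁, Θ₁, hM₁, hΘ₁, hoff⟩ := ineq2134_kOff_torus d ℓ hδG
  obtain ⟨M₂, Θ₂, hM₂, hΘ₂, hdiag⟩ := ineq2134_kDiag_torus_theta_in d ℓ hδG
  refine ⟨max M₁ M₂, max Θ₁ Θ₂, lt_max_of_lt_left hM₁, le_max_of_le_left hΘ₁, ?_⟩
  intro Mh k R P D hMh hP hR hM X blk Dg CP hCP hDg CG C₁ CN CD cD s s₁ s₂ r₀ m hCG hC₁ hCN hCD hcD hs hs₁ hs₂ hr₀ hm nE nK C _ Dc G Ml Pl h ζ c₀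
    T S Score ι DE E cf κ DK N z hnE hnK hdec hGin hEG hcf hcfT hc₀ hc₀T hh1 hhS hST hLip hNin hNout hz hPlin hPlout hζ0 hζ1 hζS hD3 hgap c hc c' hc'
  have hMi1 : M₁ ≤ ((ℓ : ℝ) + 1) * Mh := (le_max_left _ _).trans hM
  have hMi2 : M₂ ≤ ((ℓ : ℝ) + 1) * Mh := (le_max_right _ _).trans hM
  have hMpos : 0 < (geomTB D).M := M_pos_TB D hMh
  have hMinv : 0 ≤ ((geomTB D).M)⁻¹ := inv_nonneg.2 hMpos.le
  set U : ℝ := nE * (s₁ * C₁) + s₂ * CG + (nK + 1) * s * ((CN + 1) * CG * (1 + r₀)) + CD * CG / cD with hU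
  have hUnn : 0 ≤ U := by rw [hU]; positivity
  have hCGm : 0 ≤ CP * CG / m := div_nonneg (mul_nonneg hCP hCG) hm.le
  -- the common kernel dominates both packs
  have hdom : ∀ {θ : ℝ} (y y' : (geomTB D).Site), 0 ≤ θ → θ ≤ max Θ₁ Θ₂ * (CP * CG / m + U) →
      θ * ((geomTB D).M)⁻¹ * Real.exp (-(δG / 2 * (geomTB D).dist y y')) ≤
        max Θ₁ Θ₂ * (CP * CG / m + U) * ((geomTB D).M)⁻¹ * Real.exp (-(δG / 2 * (geomTB D).dist y y')) := by
    intro θ y y' hθ hθle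
    exact mul_le_mul_of_nonneg_right (mul_le_mul_of_nonneg_right hθle hMinv) (Real.exp_nonneg _)
  by_cases hcc : c = c'
  · -- the diagonal pair: (2.92), `kDiag`
    subst hcc
    have e : kFam Dg (fun c => mulOp (h c)) (fun c => mulOp (ζ c)) Ml Pl c c = kDiag Dg (mulOp (h c)) (mulOp (ζ c)) (Ml c) (Pl c) := by
      simp [kFam]
    rw [e]
    have hζabs : ∀ x, |ζ c x| ≤ 1 := fun x => abs_le.2 ⟨by linarith [hζ0 c hc x], hζ1 c hc x⟩
    have hhT : ∀ x, h c x ≠ 0 → blk x ∈ T c := fun x hx => hST c hc (hhS c hc x hx)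
    have key := hdiag D hMh hP hR hMi2 blk Dg hCG hC₁ hCN hCD hcD hs hs₁ hs₂ hr₀ (DE c) (DK c) (hdec c hc) (hGin c hc) (hEG c hc)
      (hcf c hc) (hcfT c hc) (hc₀ c hc) (hc₀T c hc) (hh1 c hc) hhT (hLip c hc) (hNin c hc) (hNout c hc) (hz c hc) (hPlin c hc) (hPlout c hc)
      hζabs (hD3 c hc)
    refine hasMajorant_mono _ key fun y y' => ?_
    have hUc : (((DE c).card : ℝ) * (s₁ * C₁) + s₂ * CG + ((DK c).card + 1) * s * ((CN + 1) * CG * (1 + r₀)) + CD * CG / cD) ≤ U := by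
      have h1 : ((DE c).card : ℝ) ≤ nE := by exact_mod_cast hnE c hc
      have h2 : ((DK c).card : ℝ) ≤ nK := by exact_mod_cast hnK c hc
      have h3 : 0 ≤ s₁ * C₁ := by positivity
      have h4 : 0 ≤ s * ((CN + 1) * CG * (1 + r₀)) := by positivity
      rw [hU]; nlinarith
    have hUc0 : 0 ≤ (((DE c).card : ℝ) * (s₁ * C₁) + s₂ * CG + ((DK c).card + 1) * s * ((CN + 1) * CG * (1 + r₀)) + CD * CG / cD) := by
      positivity
    refine hdom y y' (mul_nonneg hΘ₂ hUc0) ?_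
    calc Θ₂ * (((DE c).card : ℝ) * (s₁ * C₁) + s₂ * CG + ((DK c).card + 1) * s * ((CN + 1) * CG * (1 + r₀)) + CD * CG / cD)
        ≤ max Θ₁ Θ₂ * U := mul_le_mul (le_max_right _ _) hUc hUc0 (le_max_of_le_left hΘ₁)
      _ ≤ max Θ₁ Θ₂ * (CP * CG / m + U) := mul_le_mul_of_nonneg_left (by linarith) (le_max_of_le_left hΘ₁)
  · -- an off-diagonal pair: (2.93), `kOff` — only the local majorant on `S c' ⊆ T c'` is used
    have e : kFam Dg (fun c => mulOp (h c)) (fun c => mulOp (ζ c)) Ml Pl c c' = kOff Dg (mulOp (h c)) (mulOp (ζ c')) (mulOp (h c')) := by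
      simp [kFam, hcc]
    rw [e]
    have hGS : LocalMajorant blk (G c') (S c') (fun y y' => CG * (geomTB D).len y ^ 2 * Real.exp (-(δG * (geomTB D).dist y y'))) :=
      (inMajorant_subset blk (hGin c' hc') (hST c' hc')).localMajorant
    have key := hoff D hMh hP hR hMi1 blk hCP hCG hm (Dg := Dg) (Gl := G c') hDg hGS (hh1 c hc) (hζ0 c' hc') (hζ1 c' hc') (hζS c' hc') (hh1 c' hc')
      (hhS c' hc') (hgap c' hc')
    refine hasMajorant_mono _ key fun y y' => ?_
    have e2 : Θ₁ * CP * CG / m * ((geomTB D).M)⁻¹ = Θ₁ * (CP * CG / m) * ((geomTB D).M)⁻¹ := by ring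
    rw [e2]
    refine hdom y y' (mul_nonneg hΘ₁ hCGm) ?_
    calc Θ₁ * (CP * CG / m) ≤ max Θ₁ Θ₂ * (CP * CG / m) := mul_le_mul_of_nonneg_right (le_max_left _ _) hCGm
      _ ≤ max Θ₁ Θ₂ * (CP * CG / m + U) := mul_le_mul_of_nonneg_left (by linarith) (le_max_of_le_left hΘ₁)

/-! ## §3  The inputs `h2134` + `hsmall` of the gluing on the torus, above ONE threshold, `G_□` input-localised -/

/-- **THE INPUTS `h2134` AND `hsmall` OF `…B6Prop26Gluing.prop26_2136_of_2133_2134` ON THE TORUS, ABOVE ONE THRESHOLD, `G_□` INPUT-LOCALISED**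
(`…inputs2134_kFam_torus` with `(hG, hGout) ↦ hGin`). [cite: Balaban1984PropagatorsII, (2.134)–(2.135) p.247; (2.133) p.247; Prop. 2.6 p.247; (2.91) p.239] -/
theorem inputs2134_kFam_torus_in (d ℓ : ℕ) {δG CP CG C₁ CN CD cD s s₁ s₂ r₀ m c₁ : ℝ} (nE nK Nov : ℕ) (hδG : 0 < δG) (hCP : 0 ≤ CP)
    (hCG : 0 ≤ CG) (hC₁ : 0 ≤ C₁) (hCN : 0 ≤ CN) (hCD : 0 ≤ CD) (hcD : 0 < cD) (hs : 0 ≤ s) (hs₁ : 0 ≤ s₁) (hs₂ : 0 ≤ s₂) (hr₀ : 0 ≤ r₀)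
    (hm : 0 < m) (hc₁ : 0 ≤ c₁) :
    ∃ M₁ Θ : ℝ, 0 < M₁ ∧ 0 ≤ Θ ∧
      ∀ {Mh k R : ℕ} {P : Fin (d + 1) → ℕ} (D : B6MultiLevelTorusOperatorL0.TDomains d ℓ Mh k P R), 1 ≤ Mh → (∀ μ, 1 ≤ P μ) → 2 * (ℓ + 1) ≤ R →
        M₁ ≤ ((ℓ : ℝ) + 1) * Mh →
        (Nov : ℝ) ^ 2 * (Θ * (CP * CG / m + (nE * (s₁ * C₁) + s₂ * CG + (nK + 1) * s * ((CN + 1) * CG * (1 + r₀)) + CD * CG / cD)) *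
            ((geomTB D).M)⁻¹) * c₁ < 1 ∧
        ∀ {X : Type} (blk : X → (geomTB D).Site) {Dg : Module.End ℝ (X → ℝ)},
          HasMajorant blk Dg (fun y y'' => CP / (geomTB D).len y ^ 2 * Real.exp (-(δG * (geomTB D).dist y y''))) →
        ∀ {C : Type} [DecidableEq C] (Dc : Finset C) {G Ml Pl : C → Module.End ℝ (X → ℝ)} {h ζ c₀ : C → X → ℝ}
          {T S Score : C → Set (geomTB D).Site}
          {ι : Type} {DE : C → Finset ι} {E : C → ι → Module.End ℝ (X → ℝ)} {cf : C → ι → X → ℝ}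
          {κ : Type} {DK : C → Finset κ} {N : C → κ → Module.End ℝ (X → ℝ)} {z : C → κ → X → ℝ},
          (∀ c ∈ Dc, (DE c).card ≤ nE) → (∀ c ∈ Dc, (DK c).card ≤ nK) →
          (∀ c ∈ Dc, mulOp (h c) * Ml c - Ml c * mulOp (h c) =
            (∑ e ∈ DE c, mulOp (cf c e) * E c e - mulOp (c₀ c)) + ∑ k ∈ DK c, mulOp (z c k) * (N c k * mulOp (h c) - mulOp (h c) * N c k)) →
          (∀ c ∈ Dc, InMajorant blk (G c) (T c) (fun y y' => CG * (geomTB D).len y ^ 2 * Real.exp (-(δG * (geomTB D).dist y y')))) →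
          (∀ c ∈ Dc, ∀ e ∈ DE c,
            LocalMajorant blk (E c e * G c) (T c) (fun y y' => C₁ * (geomTB D).len y ^ 2 * Real.exp (-(δG * (geomTB D).dist y y')))) →
          (∀ c ∈ Dc, ∀ e ∈ DE c, ∀ x, |cf c e x| ≤ s₁ / ((geomTB D).M * (geomTB D).len (blk x) ^ 2)) →
          (∀ c ∈ Dc, ∀ e ∈ DE c, ∀ x, cf c e x ≠ 0 → blk x ∈ T c) →
          (∀ c ∈ Dc, ∀ x, |c₀ c x| ≤ s₂ / ((geomTB D).M * (geomTB D).len (blk x) ^ 2)) → (∀ c ∈ Dc, ∀ x, c₀ c x ≠ 0 → blk x ∈ T c) →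
          (∀ c ∈ Dc, ∀ x, |h c x| ≤ 1) → (∀ c ∈ Dc, ∀ x, h c x ≠ 0 → blk x ∈ S c) → (∀ c ∈ Dc, S c ⊆ T c) →
          (∀ c ∈ Dc, ∀ x x', |h c x' - h c x| ≤ s / (geomTB D).M * ((geomTB D).dist (blk x) (blk x') + r₀)) →
          (∀ c ∈ Dc, ∀ k ∈ DK c,
            InMajorant blk (N c k) (T c) (fun y y'' => CN / (geomTB D).len y ^ 2 * Real.exp (-(δG * (geomTB D).dist y y'')))) →
          (∀ c ∈ Dc, ∀ k ∈ DK c, ∀ (y'' : (geomTB D).Site) (μ : X → ℝ) (B : ℝ), BlockSupp blk μ y'' B → ∀ x, blk x ∈ T c →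
            |N c k μ x| ≤ CN / (geomTB D).len (blk x) ^ 2 * Real.exp (-(δG * (geomTB D).dist (blk x) y'')) * B) →
          (∀ c ∈ Dc, ∀ k ∈ DK c, ∀ x, |z c k x| ≤ 1) →
          (∀ c ∈ Dc, InMajorant blk (Pl c) (T c) (fun y y'' => CN / (geomTB D).len y ^ 2 * Real.exp (-(δG * (geomTB D).dist y y'')))) →
          (∀ c ∈ Dc, ∀ (y'' : (geomTB D).Site) (μ : X → ℝ) (B : ℝ), BlockSupp blk μ y'' B → ∀ x, blk x ∈ T c →
            |Pl c μ x| ≤ CN / (geomTB D).len (blk x) ^ 2 * Real.exp (-(δG * (geomTB D).dist (blk x) y'')) * B) →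
          (∀ c ∈ Dc, ∀ x, 0 ≤ ζ c x) → (∀ c ∈ Dc, ∀ x, ζ c x ≤ 1) → (∀ c ∈ Dc, ∀ x, ζ c x ≠ 1 → blk x ∉ Score c) →
          (∀ c ∈ Dc, HasMajorant blk (mulOp (ζ c) * (Dg - Pl c) * mulOp (h c))
            (fun y y'' => CD * Real.exp (-(cD * (geomTB D).M)) / (geomTB D).len y ^ 2 * Real.exp (-(δG * (geomTB D).dist y y'')))) →
          (∀ c ∈ Dc, ∀ y y'', y ∉ Score c → y'' ∈ S c → m * (geomTB D).M ≤ (geomTB D).dist y y'') →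
          ∀ c ∈ Dc, ∀ c' ∈ Dc,
            HasMajorant blk
              ((kFam Dg (fun c => mulOp (h c)) (fun c => mulOp (ζ c)) Ml Pl c c' * G c') * mulOp (h c'))
              (fun y y' => Θ * (CP * CG / m + (nE * (s₁ * C₁) + s₂ * CG + (nK + 1) * s * ((CN + 1) * CG * (1 + r₀)) + CD * CG / cD)) *
                ((geomTB D).M)⁻¹ * Real.exp (-(δG / 2 * (geomTB D).dist y y'))) := by
  obtain ⟨M₀, Θ, hM₀, hΘ, hall⟩ := h2134_kFam_torus_in d ℓ hδG
  have hV : 0 ≤ CP * CG / m + (nE * (s₁ * C₁) + s₂ * CG + (nK + 1) * s * ((CN + 1) * CG * (1 + r₀)) + CD * CG / cD) := by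
    have := div_nonneg (mul_nonneg hCP hCG) hm.le
    positivity
  obtain ⟨M₂, hM₂, hsmall⟩ := theta0_joint_lt (Θ := Θ) Nov hΘ hV hc₁
  refine ⟨max M₀ M₂, Θ, lt_max_of_lt_left hM₀, hΘ, fun D hMh hP hR hM => ⟨?_, ?_⟩⟩
  · have hMD : M₂ ≤ (geomTB D).M := by rw [geomTB_M]; exact (le_max_right _ _).trans hM
    exact hsmall _ hMD
  · intro X blk Dg hDg C _ Dc G Ml Pl h ζ c₀ T S Score ι DE E cf κ DK N z hnE hnK hdec hGin hEG hcf hcfT hc₀ hc₀T hh1 hhS hST hLip hNin hNout hz hPlin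
      hPlout hζ0 hζ1 hζS hD3 hgap
    exact hall D hMh hP hR ((le_max_left _ _).trans hM) blk hCP hDg hCG hC₁ hCN hCD hcD hs hs₁ hs₂ hr₀ hm nE nK Dc hnE hnK hdec hGin hEG hcf
      hcfT hc₀ hc₀T hh1 hhS hST hLip hNin hNout hz hPlin hPlout hζ0 hζ1 hζS hD3 hgap

end Literature.MathematicalPhysics.QuantumFieldTheory.Balaban1983to89.B6Ineq2134KFamKLevelTorusInL0
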